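import Literature.RingTheory.Flat.FlatLevel
import Mathlib.RingTheory.Flat.FaithfullyFlat.Algebra
import Mathlib.RingTheory.Spectrum.Prime.Chevalley
import Mathlib.RingTheory.LocalRing.ResidueField.Fiber
import Mathlib.RingTheory.LocalRing.ResidueField.Ideal
import Mathlib.RingTheory.Ideal.GoingDown
import Mathlib.RingTheory.FinitePresentation
import HarnessLib

/-!
# Faithful flatness descends to a finite level (the core of Stacks 034Y)

If `A[x]/(f)` is faithfully flat over `A`, then some `P_T` of the absolute Noetherian approximation
(`Literature.RingTheory.Flat.NoetherianApproximation`) is faithfully flat over `T` (The Stacks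
Project, Tag 034Y, first half of the proof: by Tag 02JO some `P_T` is flat over `T`; the image of
`Spec P_T → Spec T` is open with closed complement `V(I₀)`; `I₀A = A` by faithful flatness of
`A → A[x]/(f)`, and after adjoining the coefficients of a relation `Σ rₖ iₖ = 1` the map on
spectra becomes surjective).

## Main results

* `Idx.flat_of_le`: flatness of `P_T` over `T` passes to `T′ ⊇ T`.
* `Idx.exists_faithfullyFlat_level` (**Stacks 034Y, core**).

## References

* [The Stacks Project, Tags 034Y, 02JO, 00I1][StacksProject]
-/

universe u

open TensorProduct PrimeSpectrum

noncomputable section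

namespace Literature.RingTheory.Flat

namespace Idx

variable {A : Type u} [CommRing A] {n m : ℕ} {f : Fin m → MvPolynomial (Fin n) A}

/-- `P_T` is of finite presentation over `T`. [folklore] -/
instance finitePresentation_P (lam : Idx f) : Algebra.FinitePresentation lam.T lam.P := by
  change Algebra.FinitePresentation lam.T (MvPolynomial (Fin n) lam.T ⧸ lam.J)
  exact Algebra.FinitePresentation.quotient (Submodule.fg_span (Set.finite_range _))

section LE

variable {lam mu : Idx f} [Algebra lam.T mu.T] [IsScalarTower lam.T mu.T A]

/-- `P_{T′} = T′ ⊗_T P_T` as a `T′`-linear equivalence. [cite: StacksProject, Tag 00R0 (4)] -/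
theorem isBaseChange_incl :
    IsBaseChange mu.T (incl : lam.P →ₐ[lam.T] mu.P).toLinearMap := by
  letI := algebraPP (lam := lam) (mu := mu)
  haveI := isScalarTower_T_P_P (lam := lam) (mu := mu)
  have h := (isPushout_incl (lam := lam) (mu := mu)).out
  have heq : (IsScalarTower.toAlgHom lam.T lam.P mu.P).toLinearMap =
      (incl : lam.P →ₐ[lam.T] mu.P).toLinearMap := LinearMap.ext fun _ => rfl
  rwa [heq] at h

/-- **Flatness passes to larger levels** (base change). [folklore] -/
theorem flat_of_le [Module.Flat lam.T lam.P] : Module.Flat mu.T mu.P :=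
  Module.Flat.of_linearEquiv (isBaseChange_incl (lam := lam) (mu := mu)).equiv.symm

/-- If `𝔪 P_{T′} = P_{T′}` for an ideal `𝔪` of `T′`, then `P_T ⊗_T κ(𝔪)`... more precisely
`P_T ⊗_T X = 0` for every `T′`-module `X` killed by `𝔪`. [folklore] -/
theorem subsingleton_tensor_of_smul_top_eq_top (𝔪 : Ideal mu.T)
    (h : 𝔪 • (⊤ : Submodule mu.T mu.P) = ⊤) (X : Type u) [AddCommGroup X] [Module mu.T X]
    [Module lam.T X] [IsScalarTower lam.T mu.T X] (hX : ∀ (t : mu.T), t ∈ 𝔪 → ∀ x : X, t • x = 0) :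
    Subsingleton (lam.P ⊗[lam.T] X) := by
  -- `P_{T′} ⊗_{T′} X = 0`
  have hzero : ∀ (y : mu.P) (x : X), y ⊗ₜ[mu.T] x = 0 := by
    intro y x
    have hy : y ∈ 𝔪 • (⊤ : Submodule mu.T mu.P) := by rw [h]; exact Submodule.mem_top
    refine Submodule.smul_induction_on hy ?_ ?_
    · intro t ht z _
      rw [TensorProduct.smul_tmul, hX t ht x, TensorProduct.tmul_zero]
    · intro y₁ y₂ h₁ h₂
      rw [TensorProduct.add_tmul, h₁, h₂, add_zero]
  have hsub : Subsingleton (mu.P ⊗[mu.T] X) := by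
    refine subsingleton_of_forall_eq 0 fun z => ?_
    induction z using TensorProduct.induction_on with
    | zero => rfl
    | tmul y x => exact hzero y x
    | add a b ha hb => rw [ha, hb, add_zero]
  exact (betaMap_bijective (lam := lam) (mu := mu) X).1.subsingleton

end LE

/-! ### Stacks 034Y: faithful flatness at a finite level -/

omit [CommRing A] in
/-- A ring with a prime is nontrivial. [folklore] -/
theorem nontrivial_of_primeSpectrum {R : Type*} [CommRing R] (q : PrimeSpectrum R) : Nontrivial R :=
  nontrivial_of_ne (1 : R) 0 fun h => q.2.ne_top ((Ideal.eq_top_iff_one _).mpr (h ▸ q.asIdeal.zero_mem))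

/-- **Faithful flatness descends to a finite level** (The Stacks Project, Tag 034Y, core of the
proof, for the absolute Noetherian approximation `A[x]/(f) = colim P_T`): if `A[x]/(f)` is
faithfully flat over `A`, then some `P_T` is faithfully flat over `T`. Proof: by `exists_flat_level`
(Tag 02JO) some `P_T` is flat over `T`, hence so are all `P_{T′}`, `T′ ⊇ T`; the image of
`Spec P_T → Spec T` is open (Chevalley, Mathlib's
`PrimeSpectrum.isOpenMap_comap_of_hasGoingDown_of_finitePresentation`), with closed complement
`V(I₀)`; every prime of `A` contracts into the image (faithful flatness of `A → A[x]/(f)`), so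
`I₀A = A`; adjoining to `T` the coefficients of a relation `Σ rₖ iₖ = 1` gives `T′` with
`I₀T′ = T′`, and then `𝔪 P_{T′} ≠ P_{T′}` for every maximal `𝔪` of `T′` (if `𝔪 ∩ T` is in the image,
the fibre ring `κ(𝔪 ∩ T) ⊗_T P_T ≠ 0` survives the faithfully flat extension `κ(𝔪)`, while
`𝔪 P_{T′} = P_{T′}` would kill `P_T ⊗_T κ(𝔪) = P_{T′} ⊗_{T′} κ(𝔪)`). [cite: StacksProject, Tag 034Y] -/
theorem exists_faithfullyFlat_level [Module.FaithfullyFlat A (Pinf f)] :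
    ∃ mu : Idx f, Module.FaithfullyFlat mu.T mu.P := by
  classical
  obtain ⟨lam, hlam⟩ := exists_flat_level (f := f)
  haveI := hlam
  -- the image of `Spec P_T → Spec T` is open, with complement `V(I₀)`
  have hopen : IsOpen (Set.range (comap (algebraMap lam.T lam.P))) :=
    (isOpenMap_comap_of_hasGoingDown_of_finitePresentation (R := lam.T) (S := lam.P)).isOpen_range
  obtain ⟨I₀, hI₀⟩ := (isClosed_iff_zeroLocus_ideal _).mp hopen.isClosed_compl
  -- every prime of `A` contracts into the image
  have hA : ∀ (𝔭 : Ideal A) [𝔭.IsPrime], ¬I₀ ≤ 𝔭.comap (algebraMap lam.T A) := by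
    intro 𝔭 _ hle
    obtain ⟨𝔮, h𝔮, h𝔮𝔭⟩ := Ideal.exists_isPrime_liesOver_of_faithfullyFlat (B := Pinf f) 𝔭
    have hQ : (lam.qT 𝔮).comap (algebraMap lam.T lam.P) = 𝔭.comap (algebraMap lam.T A) := by
      rw [comap_qT, pT_eq_comap_pA, pA]
      exact congrArg (Ideal.comap (algebraMap lam.T A)) h𝔮𝔭.over.symm
    have hmem : (⟨𝔭.comap (algebraMap lam.T A), Ideal.IsPrime.comap _⟩ : PrimeSpectrum lam.T) ∈
        Set.range (comap (algebraMap lam.T lam.P)) :=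
      ⟨⟨lam.qT 𝔮, inferInstance⟩, PrimeSpectrum.ext hQ⟩
    have hnot : (⟨𝔭.comap (algebraMap lam.T A), Ideal.IsPrime.comap _⟩ : PrimeSpectrum lam.T) ∉
        zeroLocus (I₀ : Set lam.T) := by
      rw [← hI₀]; exact fun h => h hmem
    exact hnot ((mem_zeroLocus _ _).mpr hle)
  -- hence `I₀A = A`, and `1 = Σ rₖ iₖ`
  have htop : I₀.map (algebraMap lam.T A) = ⊤ := by
    by_contra hne
    obtain ⟨𝔪, h𝔪, hle⟩ := Ideal.exists_le_maximal _ hne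
    haveI := h𝔪.isPrime
    exact hA 𝔪 (Ideal.map_le_iff_le_comap.mp hle)
  have h1 : (1 : A) ∈ Submodule.span A (algebraMap lam.T A '' (I₀ : Set lam.T)) := by
    have : (1 : A) ∈ I₀.map (algebraMap lam.T A) := htop ▸ Submodule.mem_top
    exact this
  obtain ⟨N, r, v, hsum⟩ := Submodule.mem_span_set'.mp h1
  have hv : ∀ k, ∃ i : lam.T, i ∈ I₀ ∧ algebraMap lam.T A i = v k := fun k =>
    (Set.mem_image _ _ _).mp (v k).2
  choose i hiI hiv using hv
  -- adjoin the `rₖ`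
  let mu : Idx f := lam.adjoin (Finset.univ.image r)
  have hle : lam ≤ mu := lam.le_adjoin _
  letI := algebraOfLE hle
  haveI := isScalarTower_of_le hle
  have hr : ∀ k, r k ∈ mu.T := fun k =>
    lam.subset_adjoin _ (Finset.mem_coe.mpr (Finset.mem_image_of_mem r (Finset.mem_univ k)))
  have htop' : I₀.map (algebraMap lam.T mu.T) = ⊤ := by
    rw [Ideal.eq_top_iff_one]
    have hone : (1 : mu.T) = ∑ k, (⟨r k, hr k⟩ : mu.T) * algebraMap lam.T mu.T (i k) := by
      apply mu.algebraMap_injective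
      rw [map_one, map_sum, ← hsum]
      refine Finset.sum_congr rfl fun k _ => ?_
      rw [map_mul, smul_eq_mul, ← hiv k]
      rfl
    rw [hone]
    exact Ideal.sum_mem _ fun k _ => Ideal.mul_mem_left _ _ (Ideal.mem_map_of_mem _ (hiI k))
  refine ⟨mu, ?_⟩
  haveI : Module.Flat mu.T mu.P := flat_of_le (lam := lam) (mu := mu)
  refine ⟨fun 𝔪 h𝔪 htop𝔪 => ?_⟩
  let p : Ideal lam.T := 𝔪.comap (algebraMap lam.T mu.T)
  haveI hpprime : p.IsPrime := Ideal.IsPrime.comap _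
  by_cases hp : (⟨p, hpprime⟩ : PrimeSpectrum lam.T) ∈ Set.range (comap (algebraMap lam.T lam.P))
  · -- the fibre of `Spec P_T → Spec T` over `p` is nonempty
    obtain ⟨Q, hQ⟩ := hp
    let q : PrimeSpectrum (p.Fiber lam.P) :=
      PrimeSpectrum.preimageEquivFiber lam.T lam.P ⟨p, hpprime⟩ ⟨Q, hQ⟩
    haveI : Nontrivial (p.Fiber lam.P) := nontrivial_of_primeSpectrum q
    -- `κ(𝔪)` over `κ(p)`
    haveI : 𝔪.IsPrime := h𝔪.isPrime
    let K := 𝔪.ResidueField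
    letI : Algebra p.ResidueField K :=
      (Ideal.ResidueField.map p 𝔪 (algebraMap lam.T mu.T) rfl).toAlgebra
    haveI : IsScalarTower lam.T p.ResidueField K := IsScalarTower.of_algebraMap_eq fun t => by
      rw [IsScalarTower.algebraMap_apply lam.T mu.T K]
      exact (Ideal.ResidueField.map_algebraMap p 𝔪 (algebraMap lam.T mu.T) rfl t).symm
    haveI : Module.FaithfullyFlat p.ResidueField K := inferInstance
    haveI h1 : Nontrivial (K ⊗[p.ResidueField] (p.ResidueField ⊗[lam.T] lam.P)) :=
      Module.FaithfullyFlat.lTensor_nontrivial p.ResidueField K _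
    haveI h2 : Nontrivial (K ⊗[lam.T] lam.P) :=
      (TensorProduct.AlgebraTensorModule.cancelBaseChange lam.T p.ResidueField K K lam.P).symm.toEquiv.nontrivial
    haveI h3 : Nontrivial (lam.P ⊗[lam.T] K) := (TensorProduct.comm lam.T lam.P K).toEquiv.nontrivial
    -- but `𝔪 P_{T′} = P_{T′}` kills `P_T ⊗_T κ(𝔪)`
    haveI h4 : Subsingleton (lam.P ⊗[lam.T] K) :=
      subsingleton_tensor_of_smul_top_eq_top 𝔪 htop𝔪 K fun t ht x => by
        rw [Algebra.smul_def, Ideal.algebraMap_residueField_eq_zero.mpr ht, zero_mul]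
    exact false_of_nontrivial_of_subsingleton (lam.P ⊗[lam.T] K)
  · -- `p ∉ image`: then `I₀ ⊆ p`, so `T′ = I₀T′ ⊆ 𝔪`
    have hp' : (⟨p, hpprime⟩ : PrimeSpectrum lam.T) ∈ zeroLocus (I₀ : Set lam.T) := by
      rw [← hI₀]; exact hp
    rw [mem_zeroLocus] at hp'
    have hle' : I₀.map (algebraMap lam.T mu.T) ≤ 𝔪 := Ideal.map_le_iff_le_comap.mpr hp'
    rw [htop'] at hle'
    exact h𝔪.ne_top (top_le_iff.mp hle')

end Idx

end Literature.RingTheory.Flat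

end
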